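import Mathlib.Analysis.SpecificLimits.Basic
import Mathlib.Topology.Algebra.InfiniteSum.Real
import Literature.Analysis.FluidPDE.StationaryEulerTorusGrid
import Literature.Analysis.FluidPDE.StationaryEulerRelaxationHighDim
import Literature.Analysis.FluidPDE.ConvexIntegration2DIteration
import HarnessLib

/-!
# Tools for the stub `stub_boxIteration` (crux `PointSink.PointFluxCone`,
stmt-AnomalousDissipation-19033, line `Sketch`)

Bookkeeping for the explicit convex-integration iteration in the unit box of `ℝ³` with pressure
(the box version of the tree's `Literature/Analysis/FluidPDE/StationaryEulerIteration.lean`,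
Choffrut–Székelyhidi 2014, §2 Step 3):

* `boxIter_sum_half_pow_le`: the tolerances `θ 2^{-(k+1)}` have partial sums `≤ θ`;
* `boxIter_gram`: the energy bookkeeping of the scheme, abstractly, for a "Gram matrix"
  `B m n = ⟨w_m, w_n⟩`: near-orthogonality of the increments to the previous states and a uniform
  bound give monotone bounded corrected energies, hence the `L²` Cauchy property, and the
  summability (hence decay) of the defects;
* integrability and `L²` pairing identities for continuous fields vanishing off the box;
* the uniform bound on states of `𝒰_e`, `e ≤ ē`;
* the classical conservation laws `div v = 0`, `div (u + π I) = 0` are preserved when a wave packet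
  (`Packet.div_velC`, `Packet.div_strSC`, `u = S - q I`) is added to the state and its pressure `q`
  to `π`.

References: A. Choffrut, L. Székelyhidi Jr., SIAM J. Math. Anal. 46 (2014), §2 Step 3.
-/

noncomputable section

open scoped InnerProductSpace ContDiff ENNReal Topology
open Set Function MeasureTheory Metric Filter
open Literature.Analysis.FluidPDE Literature.Analysis.FluidPDE.StationaryEuler
open Literature.Analysis.FunctionSpaces

set_option linter.dupNamespace false

namespace Summit.AnomalousDissipation.AnomalousDissipation.Theorems

/-! ## Tolerances -/

/-- Partial sums of the tolerances `θ 2^{-(k+1)}` are at most `θ`. [folklore] -/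
theorem boxIter_sum_half_pow_le {θ : ℝ} (hθ : 0 ≤ θ) (n : ℕ) :
    ∑ k ∈ Finset.range n, θ / 2 ^ (k + 1) ≤ θ := by
  -- adapted from Literature/Analysis/FluidPDE/StationaryEulerIteration.lean (`IterData.sum_eps_le`)
  have h : ∀ k : ℕ, θ / 2 ^ (k + 1) = θ / 2 * (1 / 2) ^ k := fun k => by
    rw [one_div, inv_pow, pow_succ]; ring
  simp only [h, ← Finset.mul_sum]
  calc θ / 2 * ∑ k ∈ Finset.range n, (1 / 2 : ℝ) ^ k ≤ θ / 2 * 2 :=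
        mul_le_mul_of_nonneg_left (sum_geometric_two_le n) (by positivity)
    _ = θ := by ring

/-! ## Gram-matrix bookkeeping -/

/-- **Energy bookkeeping of the convex-integration scheme** (abstract form). For a symmetric
"Gram matrix" `B m n = ⟨w_m, w_n⟩` with `‖w_m - w_n‖² = B m m - 2 B m n + B n n ≥ 0`, increments
`W_k = w_{k+1} - w_k` nearly orthogonal to all previous states (`|⟨W_k, w_j⟩| ≤ ε_k`, `j ≤ k`),
summable tolerances (`Σ ε ≤ θ`) and bounded energies (`B k k ≤ R`): the corrected energies
`B k k + 2 Σ_{i<k} ε_i` are monotone and bounded, so (i) the states are Cauchy,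
`‖w_m - w_n‖² → 0`; (ii) any non-negative defects with `J_k - ε_k ≤ ‖W_k‖²` are summable, hence
tend to zero. [cite: ChoffrutSzekelyhidi2014, §2 Step 3] -/
theorem boxIter_gram (B : ℕ → ℕ → ℝ) (ε : ℕ → ℝ) (θ R : ℝ)
    (hpsd : ∀ m n, 0 ≤ B m m - 2 * B m n + B n n)
    (hεs : ∀ n, ∑ k ∈ Finset.range n, ε k ≤ θ)
    (horth : ∀ j k, j ≤ k → |B (k + 1) j - B k j| ≤ ε k)
    (hsymm : ∀ m n, B m n = B n m) (hR : ∀ k, B k k ≤ R) :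
    (∀ η : ℝ, 0 < η → ∃ M : ℕ, ∀ n m, M ≤ n → n ≤ m → B m m - 2 * B m n + B n n < η) ∧
    ∀ J : ℕ → ℝ, (∀ k, 0 ≤ J k) →
      (∀ k, J k - ε k ≤ B (k + 1) (k + 1) - 2 * B (k + 1) k + B k k) → Tendsto J atTop (𝓝 0) := by
  -- adapted from Literature/Analysis/FluidPDE/StationaryEulerIteration.lean (`F_monotone`, `ip_sub_le`,
  -- `cauchy`, `J_le`, `sum_J_le`, `tendsto_J`)
  have hstep : ∀ k, B k k - 2 * ε k ≤ B (k + 1) (k + 1) := by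
    intro k
    have h1 := horth k k le_rfl
    have h2 := hpsd (k + 1) k
    have h3 := neg_abs_le (B (k + 1) k - B k k)
    have h4 := hsymm (k + 1) k
    linarith
  -- corrected energies
  obtain ⟨F, hF⟩ : ∃ F : ℕ → ℝ, ∀ k, F k = B k k + 2 * ∑ i ∈ Finset.range k, ε i := ⟨_, fun _ => rfl⟩
  have hFmono : Monotone F := by
    refine monotone_nat_of_le_succ fun k => ?_
    rw [hF, hF, Finset.sum_range_succ]
    linarith [hstep k]
  have hFle : ∀ k, F k ≤ R + 2 * θ := fun k => by rw [hF]; linarith [hR k, hεs k]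
  -- telescoping the near-orthogonality
  have key : ∀ n j, -(∑ i ∈ Finset.range j, ε (n + i)) ≤ B (n + j) n - B n n := by
    intro n j
    induction j with
    | zero => simp
    | succ j ih =>
      rw [Finset.sum_range_succ, ← Nat.add_assoc]
      have h1 := horth n (n + j) (Nat.le_add_right n j)
      have h2 := neg_abs_le (B (n + j + 1) n - B (n + j) n)
      linarith
  have hincr : ∀ n m, n ≤ m → B m m - 2 * B m n + B n n ≤ F m - F n := by
    intro n m hnm
    obtain ⟨j, rfl⟩ := Nat.exists_eq_add_of_le hnm
    have h1 := key n j
    have h2 : ∑ i ∈ Finset.range (n + j), ε i =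
        ∑ i ∈ Finset.range n, ε i + ∑ i ∈ Finset.range j, ε (n + i) := Finset.sum_range_add ε n j
    rw [hF, hF, h2]
    linarith
  refine ⟨fun η hη => ?_, fun J hJ0 hJ => ?_⟩
  · obtain ⟨M, hM⟩ := ConvexIntegration.exists_forall_sub_lt_of_monotone hFmono hFle hη
    exact ⟨M, fun n m hn hnm => (hincr n m hnm).trans_lt (hM n m hn hnm)⟩
  · have hJle : ∀ k, J k ≤ B (k + 1) (k + 1) - B k k + 3 * ε k := by
      intro k
      have h1 := horth k k le_rfl
      have h2 := hJ k
      have h3 := neg_le_abs (B (k + 1) k - B k k)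
      have h4 := hsymm (k + 1) k
      linarith
    have htel : ∀ n, ∑ k ∈ Finset.range n, (B (k + 1) (k + 1) - B k k) = B n n - B 0 0 :=
      fun n => Finset.sum_range_sub (fun k => B k k) n
    have hsumJ : ∀ n, ∑ k ∈ Finset.range n, J k ≤ R - B 0 0 + 3 * θ := by
      intro n
      have h1 : ∑ k ∈ Finset.range n, J k ≤
          ∑ k ∈ Finset.range n, (B (k + 1) (k + 1) - B k k + 3 * ε k) :=
        Finset.sum_le_sum fun k _ => hJle k
      rw [Finset.sum_add_distrib, htel, ← Finset.mul_sum] at h1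
      linarith [hR n, hεs n]
    exact (summable_of_sum_range_le hJ0 hsumJ).tendsto_atTop_zero

/-! ## Integrability and pairings of fields vanishing off the box -/

/-- The unit box of `ℝ³` is bounded. [folklore] -/
theorem boxIter_box_subset_closedBall :
    box (Fin 3) ⊆ closedBall (0 : Ed (Fin 3)) (Real.sqrt (Fintype.card (Fin 3))) := by
  rw [← refCube_frame0]; exact refCube_subset_closedBall _

/-- Continuous functions on `ℝ³` vanishing off the unit box are integrable. [folklore] -/
theorem boxIter_integrable {F : Type*} [NormedAddCommGroup F] {f : Ed (Fin 3) → F}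
    (hf : Continuous f) (h0 : ∀ x, x ∉ box (Fin 3) → f x = 0) : Integrable f :=
  hf.integrable_of_hasCompactSupport (HasCompactSupport.intro (isCompact_closedBall _ _)
    fun x hx => h0 x fun hb => hx (boxIter_box_subset_closedBall hb))

/-- `∫ ‖f - g‖² = ∫⟪f, f⟫ - 2 ∫⟪f, g⟫ + ∫⟪g, g⟫` for continuous fields vanishing off the box. [folklore] -/
theorem boxIter_integral_norm_sub_sq {f g : Ed (Fin 3) → State (Fin 3)} (hf : Continuous f)
    (hg : Continuous g) (hf0 : ∀ x, x ∉ box (Fin 3) → f x = 0) (hg0 : ∀ x, x ∉ box (Fin 3) → g x = 0) :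
    ∫ x, ‖f x - g x‖ ^ 2 =
      (∫ x, ⟪f x, f x⟫_ℝ) - 2 * (∫ x, ⟪f x, g x⟫_ℝ) + ∫ x, ⟪g x, g x⟫_ℝ := by
  -- adapted from Literature/Analysis/FluidPDE/StationaryEulerIteration.lean (`E_succ`)
  have i1 : Integrable fun x => ⟪f x, f x⟫_ℝ :=
    boxIter_integrable (hf.inner hf) fun x hx => by simp [hf0 x hx]
  have i2 : Integrable fun x => ⟪f x, g x⟫_ℝ :=
    boxIter_integrable (hf.inner hg) fun x hx => by simp [hf0 x hx]
  have i3 : Integrable fun x => ⟪g x, g x⟫_ℝ :=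
    boxIter_integrable (hg.inner hg) fun x hx => by simp [hg0 x hx]
  have h : (fun x => ‖f x - g x‖ ^ 2) = fun x => ⟪f x, f x⟫_ℝ - 2 * ⟪f x, g x⟫_ℝ + ⟪g x, g x⟫_ℝ := by
    funext x; rw [norm_sub_sq_real, ← real_inner_self_eq_norm_sq, ← real_inner_self_eq_norm_sq]
  have i12 : Integrable fun x => ⟪f x, f x⟫_ℝ - 2 * ⟪f x, g x⟫_ℝ := i1.sub (i2.const_mul 2)
  rw [h, integral_add i12 i3, integral_sub i1 (i2.const_mul 2), integral_const_mul]

/-- `∫⟪f + F, g⟫ = ∫⟪f, g⟫ + ∫⟪F, g⟫` for continuous fields, `f`, `F` vanishing off the box. [folklore] -/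
theorem boxIter_integral_inner_add {f F g : Ed (Fin 3) → State (Fin 3)} (hf : Continuous f)
    (hF : Continuous F) (hg : Continuous g) (hf0 : ∀ x, x ∉ box (Fin 3) → f x = 0)
    (hF0 : ∀ x, x ∉ box (Fin 3) → F x = 0) :
    ∫ x, ⟪f x + F x, g x⟫_ℝ = (∫ x, ⟪f x, g x⟫_ℝ) + ∫ x, ⟪F x, g x⟫_ℝ := by
  have i1 : Integrable fun x => ⟪f x, g x⟫_ℝ :=
    boxIter_integrable (hf.inner hg) fun x hx => by simp [hf0 x hx]
  have i2 : Integrable fun x => ⟪F x, g x⟫_ℝ :=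
    boxIter_integrable (hF.inner hg) fun x hx => by simp [hF0 x hx]
  simp_rw [inner_add_left]
  exact integral_add i1 i2

/-- `∫⟪f, f⟫ ≤ R²` for a continuous field vanishing off the unit box and bounded by `R`
(the box has volume one). [folklore] -/
theorem boxIter_integral_inner_self_le {f : Ed (Fin 3) → State (Fin 3)} (hf : Continuous f)
    (hf0 : ∀ x, x ∉ box (Fin 3) → f x = 0) {R : ℝ} (hR : ∀ x, ‖f x‖ ≤ R) :
    ∫ x, ⟪f x, f x⟫_ℝ ≤ R ^ 2 := by
  have h1 : ∫ x, ⟪f x, f x⟫_ℝ = ∫ x in box (Fin 3), ‖f x‖ ^ 2 := by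
    simp_rw [real_inner_self_eq_norm_sq]
    exact (setIntegral_eq_integral_of_forall_compl_eq_zero fun x hx => by simp [hf0 x hx]).symm
  rw [h1]
  have hfin : volume (box (Fin 3)) ≠ ⊤ := by rw [volume_box]; exact ENNReal.one_ne_top
  calc ∫ x in box (Fin 3), ‖f x‖ ^ 2 ≤ ∫ _ in box (Fin 3), R ^ 2 := by
        refine setIntegral_mono_on ?_ (integrableOn_const hfin) isOpen_box.measurableSet fun x _ => ?_
        · exact (boxIter_integrable (hf.norm.pow 2) fun x hx => by simp [hf0 x hx]).integrableOn
        · exact pow_le_pow_left₀ (norm_nonneg _) (hR x) 2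
    _ = R ^ 2 := by rw [setIntegral_const, measureReal_def, volume_box, ENNReal.toReal_one, one_smul]

/-- **States of `𝒰_e`, `e ≤ ē`, are uniformly bounded** by `√ē + 9 ē`. [cite: ChoffrutSzekelyhidi2014, §2 Step 1] -/
theorem boxIter_norm_le_of_mem_U {r ebar : ℝ} (hr : r ≤ ebar) {w : State (Fin 3)} (hw : w ∈ HighDim.U r) :
    ‖w‖ ≤ Real.sqrt ebar + 3 * ebar * 3 := by
  have hC := HighDim.U_subset_C r hw
  have h0 : 0 ≤ r := nonneg_of_mem_C hC
  have h := norm_le_of_mem_C hC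
  rw [Fintype.card_fin] at h
  push_cast at h
  calc ‖w‖ ≤ Real.sqrt r + 3 * r * 3 := h
    _ ≤ Real.sqrt ebar + 3 * ebar * 3 := by gcongr

/-! ## The classical conservation laws along the iteration -/

/-- **`div v` is preserved**: adding a wave packet's field to a smooth state field with classically
divergence-free velocity keeps the velocity divergence free (`div velC = 0`). [cite: ChoffrutSzekelyhidi2014, Lemma 3] -/
theorem boxIter_div_vel_step {w : Ed (Fin 3) → State (Fin 3)} (hw : ContDiff ℝ ∞ w) (P : Packet (Fin 3))
    {x : Ed (Fin 3)} (h : ∑ i, pd (eb i) (fun y => vel (w y) i) x = 0) :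
    ∑ i, pd (eb i) (fun y => vel (w y + Packet.field P y) i) x = 0 := by
  -- adapted from Literature/Analysis/FluidPDE/StationaryEulerTorusBlocks.lean (`Packet.div_velC`)
  have hwi : ∀ i, Differentiable ℝ fun y => vel (w y) i := fun i =>
    differentiable_of_smooth (contDiff_euclidean.1 hw (Sum.inl i))
  have hsplit : ∀ i, pd (eb i) (fun y => vel (w y + Packet.field P y) i) =
      fun y => pd (eb i) (fun y => vel (w y) i) y + pd (eb i) (Packet.velC P i) y := by
    intro i
    have hf : (fun y => vel (w y + Packet.field P y) i) = fun y => vel (w y) i + Packet.velC P i y := by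
      funext y; rw [vel_add, PiLp.add_apply, Packet.vel_field_apply]
    rw [hf]
    exact pd_add (hwi i) (differentiable_of_smooth (Packet.contDiff_velC P i)) _
  simp only [hsplit]
  rw [Finset.sum_add_distrib, h, Packet.div_velC, add_zero]

/-- **`div (u + π I)` is preserved**: adding a wave packet's field to the state and its pressure
`q` to `π` keeps `div (u + π I) = 0` classically (`u_P = S - q I`, `div S = 0` row-wise).
[cite: ChoffrutSzekelyhidi2014, Lemma 3] -/
theorem boxIter_div_str_step {w : Ed (Fin 3) → State (Fin 3)} (hw : ContDiff ℝ ∞ w) {π : Ed (Fin 3) → ℝ}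
    (hπ : ContDiff ℝ ∞ π) (P : Packet (Fin 3)) {x : Ed (Fin 3)} {i : Fin 3}
    (h : ∑ j, pd (eb j) (fun y => str (w y) i j + (if i = j then π y else 0)) x = 0) :
    ∑ j, pd (eb j) (fun y => str (w y + Packet.field P y) i j +
      (if i = j then π y + Packet.prC P y else 0)) x = 0 := by
  -- adapted from Literature/Analysis/FluidPDE/StationaryEulerTorusBlocks.lean (`Packet.div_strSC`)
  have hd : ∀ j, Differentiable ℝ fun y => str (w y) i j + (if i = j then π y else 0) := by
    intro j
    refine (differentiable_of_smooth (contDiff_euclidean.1 hw (Sum.inr (i, j)))).add ?_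
    by_cases hij : i = j
    · simp only [if_pos hij]; exact differentiable_of_smooth hπ
    · simp only [if_neg hij]; exact differentiable_const _
  have hsplit : ∀ j, pd (eb j) (fun y => str (w y + Packet.field P y) i j +
        (if i = j then π y + Packet.prC P y else 0)) =
      fun y => pd (eb j) (fun y => str (w y) i j + (if i = j then π y else 0)) y +
        pd (eb j) (Packet.strSC P i j) y := by
    intro j
    have hf : (fun y => str (w y + Packet.field P y) i j + (if i = j then π y + Packet.prC P y else 0)) =
        fun y => (str (w y) i j + (if i = j then π y else 0)) + Packet.strSC P i j y := by
      funext y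
      rw [str_add, Matrix.add_apply, Packet.str_field_apply]
      split_ifs <;> ring
    rw [hf]
    exact pd_add (hd j) (differentiable_of_smooth (Packet.contDiff_strSC P i j)) _
  simp only [hsplit]
  rw [Finset.sum_add_distrib, h, Packet.div_strSC, add_zero]

/-! ## The registered sub-stub -/

/-- **Tools for `stub_boxIteration`** (registered sub-stub `stub_boxIterationTools`): the
conjunction of `boxIter_sum_half_pow_le`, `boxIter_gram`, `boxIter_integral_norm_sub_sq`,
`boxIter_integral_inner_add`, `boxIter_integral_inner_self_le`, `boxIter_norm_le_of_mem_U`,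
`boxIter_div_vel_step`, `boxIter_div_str_step`. [cite: ChoffrutSzekelyhidi2014, §2 Step 3] -/
theorem stub_boxIterationTools :
    (∀ (θ : ℝ), 0 ≤ θ → ∀ n : ℕ, ∑ k ∈ Finset.range n, θ / 2 ^ (k + 1) ≤ θ) ∧
    (∀ (B : ℕ → ℕ → ℝ) (ε : ℕ → ℝ) (θ R : ℝ),
      (∀ m n, 0 ≤ B m m - 2 * B m n + B n n) → (∀ n, ∑ k ∈ Finset.range n, ε k ≤ θ) →
      (∀ j k, j ≤ k → |B (k + 1) j - B k j| ≤ ε k) → (∀ m n, B m n = B n m) → (∀ k, B k k ≤ R) →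
      (∀ η : ℝ, 0 < η → ∃ M : ℕ, ∀ n m, M ≤ n → n ≤ m → B m m - 2 * B m n + B n n < η) ∧
      ∀ J : ℕ → ℝ, (∀ k, 0 ≤ J k) →
        (∀ k, J k - ε k ≤ B (k + 1) (k + 1) - 2 * B (k + 1) k + B k k) → Tendsto J atTop (𝓝 0)) ∧
    (∀ (f g : Ed (Fin 3) → State (Fin 3)), Continuous f → Continuous g →
      (∀ x, x ∉ box (Fin 3) → f x = 0) → (∀ x, x ∉ box (Fin 3) → g x = 0) →
      ∫ x, ‖f x - g x‖ ^ 2 = (∫ x, ⟪f x, f x⟫_ℝ) - 2 * (∫ x, ⟪f x, g x⟫_ℝ) + ∫ x, ⟪g x, g x⟫_ℝ) ∧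
    (∀ (f F g : Ed (Fin 3) → State (Fin 3)), Continuous f → Continuous F → Continuous g →
      (∀ x, x ∉ box (Fin 3) → f x = 0) → (∀ x, x ∉ box (Fin 3) → F x = 0) →
      ∫ x, ⟪f x + F x, g x⟫_ℝ = (∫ x, ⟪f x, g x⟫_ℝ) + ∫ x, ⟪F x, g x⟫_ℝ) ∧
    (∀ (f : Ed (Fin 3) → State (Fin 3)), Continuous f → (∀ x, x ∉ box (Fin 3) → f x = 0) →
      ∀ R : ℝ, (∀ x, ‖f x‖ ≤ R) → ∫ x, ⟪f x, f x⟫_ℝ ≤ R ^ 2) ∧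
    (∀ (r ebar : ℝ), r ≤ ebar → ∀ w : State (Fin 3), w ∈ HighDim.U r →
      ‖w‖ ≤ Real.sqrt ebar + 3 * ebar * 3) ∧
    (∀ (w : Ed (Fin 3) → State (Fin 3)), ContDiff ℝ ∞ w → ∀ (P : Packet (Fin 3)) (x : Ed (Fin 3)),
      ∑ i, pd (eb i) (fun y => vel (w y) i) x = 0 →
      ∑ i, pd (eb i) (fun y => vel (w y + Packet.field P y) i) x = 0) ∧
    (∀ (w : Ed (Fin 3) → State (Fin 3)), ContDiff ℝ ∞ w → ∀ (π : Ed (Fin 3) → ℝ), ContDiff ℝ ∞ π →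
      ∀ (P : Packet (Fin 3)) (x : Ed (Fin 3)) (i : Fin 3),
      ∑ j, pd (eb j) (fun y => str (w y) i j + (if i = j then π y else 0)) x = 0 →
      ∑ j, pd (eb j) (fun y => str (w y + Packet.field P y) i j +
        (if i = j then π y + Packet.prC P y else 0)) x = 0) :=
  ⟨fun _ hθ n => boxIter_sum_half_pow_le hθ n, boxIter_gram,
    fun _ _ hf hg hf0 hg0 => boxIter_integral_norm_sub_sq hf hg hf0 hg0,
    fun _ _ _ hf hF hg hf0 hF0 => boxIter_integral_inner_add hf hF hg hf0 hF0,
    fun _ hf hf0 _ hR => boxIter_integral_inner_self_le hf hf0 hR,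
    fun _ _ hr _ hw => boxIter_norm_le_of_mem_U hr hw,
    fun _ hw P _ h => boxIter_div_vel_step hw P h,
    fun _ hw _ hπ P _ _ h => boxIter_div_str_step hw hπ P h⟩

end Summit.AnomalousDissipation.AnomalousDissipation.Theorems
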